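import Summits.QuantumFields.BalabanUV.Beta.GAN24.TaylorDiffLam
import Summits.QuantumFields.BalabanUV.Beta.GAN24.TaylorRowLamTableAt

/-!
# `BalabanUV.Beta.GAN24.TaylorDiffLamAt` — binder row G-an2-4 / (CONV-C), S-slot, road «S3-Taylor», DIFF row R3-dL AT THE IN-BLOCK ROOT `r`, part 1:
# the Λ-table instance of leaf-11's three-leg telescoping bound for the ROOTED table `onLat (Lc^{ℓ+1}) (avgLift (Lc^ℓ) ∘ hessFFAt (toSite r) Lc μ)`
# (twin of `TaylorDiffLam` §3; §1–§2 of the base are root-free and used BY NAME)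

NOT IN PRINT; OUR BOOKKEEPING.  HONEST FRAMING (cell contract, verbatim): «discharging `BetaPertH` makes Bałaban's UV stability UNCONDITIONAL —
a real constructive-QFT result; it is NOT the continuum limit and NOT the Clay problem.»  HONEST DEPENDENCY (verbatim): «continuum YM on T⁴ ⇐
BetaPertH ∧ nine spine estimates (0/9 proved); BetaPertH ⇐ (D1) ∧ (D4) ∧ CAP+tail; G-an2-4 gates asym, D1 and NE2/3/4.»  [folklore] real
analysis: the proof of the base theorem VERBATIM with an1's ROOTED constraint Hessian `hessFFAt (toSite r) Lc` (`r ∈ box (d+1) Lc`,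
`AveragingHessianKernelsRooted`) in place of `hessFF Lc = hessFFAt 0 Lc`, the support ∕ mass inputs from (ρ-c)'s `TaylorRowLamAt.mem_boxW_of_ne_zero` ∕
`mem_imageY_of_ne_zero` ∕ `table_mass_le` (leaf-06 g40, p298699) and the root-free `TaylorDiffLam.sandwich_sub_le` (leaf-11) BY NAME; same theorem name in
this namespace; no cited fact, no `def`, no `Prop` mirror, 0 sorry; nothing of the base module is edited.  Discharges NOTHING of (hS, hSall), of the rooted
DIFF row `diffL_three_at` (parts 2–4 ahead: `S3DiffLVertexAt` ∕ `S3DiffLAlignedAt` ∕ `S3DiffLAt`), of hBdev; NEVER «G-an2-4 closed»; NOT (CONV-C) as typed,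
NOT D1, NOT BetaPertH, NOT continuum, NOT Clay.  «ROOTED-S3-Λ-DIFF» (the UNDRESSED top-aligned pair letter of `GAN24/BornLambdaDriftSup`'s socket, in road S3's
sup currency), typed by `b2b-balaban-gan24-formalise-leaf-06` gen 41.
-/

noncomputable section

open Finset
open scoped BigOperators
open Literature.MathematicalPhysics.QuantumFieldTheory
open Literature.MathematicalPhysics.QuantumFieldTheory.Balaban1983to89
open Literature.MathematicalPhysics.QuantumFieldTheory.Balaban1983to89.Beta
open Literature.Probability.LatticeModels (Torus.proj Torus.proj_apply)
open AffineAveraging (Site box toSite)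
open LatticeForm (quo)
open B12Sec2to5 (l1 l1_nonneg)
open ExpKernelCalculus (MKer Zl BiLoc l1_sub_triangle l1_sub_symm l1_natSmul)
open OneStepResolventKernel (Fib KInv LocStencil proj_zsmul quo_zsmul)
open InterLevelTransport (avgLift onLat onLat_zsmul onLat_off)
open AveragingHessianKernels (ell)
open AveragingHessianKernelsRooted (hessFFAt)
open Summit.QuantumFields.BalabanUV.Beta.GAN24.TaylorSandwich (sandwich_bound sandwich_summable tsum_u_eq_sum tsum_w_eq_sum)
open Summit.QuantumFields.BalabanUV.Beta.GAN24.TaylorRowLam (l1_le_of_mem_imageY l1_le_of_mem_box)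
open Summit.QuantumFields.BalabanUV.Beta.GAN24.TaylorRowLamAt (table_mass_le mem_boxW_of_ne_zero mem_imageY_of_ne_zero)
open Summit.QuantumFields.BalabanUV.Beta.GAN24.TaylorDiffLam (sandwich_sub_le)

namespace Summit.QuantumFields.BalabanUV.Beta.GAN24.TaylorDiffLamAt

variable {d : ℕ} {Lc : ℕ} [NeZero Lc] {r : Fin (d + 1) → ℕ}

/-! ## §3 The Λ-table instance of the three-leg telescoping bound -/

/-- [folklore] **THREE-LEG TELESCOPING OF THE ROOTED Λ SANDWICH WITH ABSTRACT LEGS** (in-block root `r ∈ box (d+1) Lc`; member `N = Lc^{ℓ+k+1}`, level `M = Lc^ℓ`, inner blocking `N′ = Lc^{ℓ+1}`; `Mass(ℓ) = #S_w(ℓ)·(d+1)²·#box_Y·2ℓ(Lc)²∕M^{2(d+1)}` from (ρ-c)'s rooted `TaylorRowLamAt.table_mass_le` — the SAME mass as at the corner root):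
`|SW(A′,H′,B′) − SW(A,H,B)| ≤ (d+1)·(dA·CB′·CH′ + CA·CB′·dH + CA·dB·CH)·Mass(ℓ)·K_W·K_U·Zl_{d+1}(κ∕2)·e^{−(κ∕2)(|x′−u′|₁+|z′−u′|₁)}`. -/
theorem lamSandwich_sub_le (hr : r ∈ box (d + 1) Lc) (ℓ k p : ℕ) (hp : p = ℓ + k + 1) {κ CA CB CH CA' CB' CH' dA dB dH : ℝ} (hκ : 0 < κ)
    {x' u' z' : Site (d + 1)} {A B H A' B' H' : Fin (d + 1) → Site (d + 1) → ℝ}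
    (hA : ∀ l w, |A l w| ≤ CA * Real.exp (-κ * l1 (x' - quo (Lc ^ p) w)))
    (hB : ∀ l' y, |B l' y| ≤ CB * Real.exp (-κ * l1 (quo (Lc ^ p) y - z')))
    (hH : ∀ μ v, |H μ v| ≤ CH * Real.exp (-κ * l1 (quo (Lc ^ p) v - u')))
    (hA' : ∀ l w, |A' l w| ≤ CA' * Real.exp (-κ * l1 (x' - quo (Lc ^ p) w)))
    (hB' : ∀ l' y, |B' l' y| ≤ CB' * Real.exp (-κ * l1 (quo (Lc ^ p) y - z')))
    (hH' : ∀ μ v, |H' μ v| ≤ CH' * Real.exp (-κ * l1 (quo (Lc ^ p) v - u')))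
    (hdA : ∀ l w, |A' l w - A l w| ≤ dA * Real.exp (-κ * l1 (x' - quo (Lc ^ p) w)))
    (hdB : ∀ l' y, |B' l' y - B l' y| ≤ dB * Real.exp (-κ * l1 (quo (Lc ^ p) y - z')))
    (hdH : ∀ μ v, |H' μ v - H μ v| ≤ dH * Real.exp (-κ * l1 (quo (Lc ^ p) v - u'))) :
    |(∑' y : Site (d + 1), ∑ l' : Fin (d + 1),
        (∑' w : Site (d + 1), ∑ l : Fin (d + 1), A' l w *
            ∑ μ : Fin (d + 1), ((((Lc ^ p : ℕ) : ℝ)) ^ (d + 1))⁻¹ * ∑' v : Site (d + 1),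
              H' μ v * onLat (Lc ^ (ℓ + 1)) (fun Y => avgLift (Lc ^ ℓ) (hessFFAt (toSite r) Lc μ Y)) v w y (Sum.inl l) (Sum.inl l')) * B' l' y) -
      ∑' y : Site (d + 1), ∑ l' : Fin (d + 1),
        (∑' w : Site (d + 1), ∑ l : Fin (d + 1), A l w *
            ∑ μ : Fin (d + 1), ((((Lc ^ p : ℕ) : ℝ)) ^ (d + 1))⁻¹ * ∑' v : Site (d + 1),
              H μ v * onLat (Lc ^ (ℓ + 1)) (fun Y => avgLift (Lc ^ ℓ) (hessFFAt (toSite r) Lc μ Y)) v w y (Sum.inl l) (Sum.inl l')) * B l' y| ≤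
      ((d : ℝ) + 1) * ((dA * CB' * CH' + CA * CB' * dH + CA * dB * CH) *
          ((((2 * (2 * (2 * (d + 1) * (Lc + 1) * Lc ^ ℓ)) + 1) ^ (d + 1) : ℕ) : ℝ) * (((d : ℝ) + 1) * (((d : ℝ) + 1) *
            ((((2 * (4 * (d + 1) + 1) + 1) ^ (d + 1) : ℕ) : ℝ) * (2 * (ell (d + 1) Lc : ℝ) ^ 2 / ((Lc : ℝ) ^ ℓ) ^ (2 * (d + 1))))))) *
          (Real.exp (κ * (((d : ℝ) + 1) * (4 * ((d : ℝ) + 1) * (Lc + 1)) + (d + 1))) *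
            Real.exp (κ * (((d : ℝ) + 1) * ((4 * ((d : ℝ) + 1) + 1) + 1) + (d + 1))))) *
        Zl (d + 1) (κ / 2) * Real.exp (-(κ / 2) * (l1 (x' - u') + l1 (z' - u'))) := by
  subst hp
  have hL0 : (0 : ℝ) < Lc := by exact_mod_cast Nat.pos_of_ne_zero (NeZero.ne Lc)
  have hL1 : (1 : ℝ) ≤ Lc := by exact_mod_cast (Nat.one_le_iff_ne_zero.2 (NeZero.ne Lc))
  haveI hN0 : NeZero (Lc ^ (ℓ + k + 1)) := ⟨pow_ne_zero _ (NeZero.ne Lc)⟩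
  haveI hNp0 : NeZero (Lc ^ (ℓ + 1)) := ⟨pow_ne_zero _ (NeZero.ne Lc)⟩
  haveI hM0 : NeZero (Lc ^ ℓ) := ⟨pow_ne_zero _ (NeZero.ne Lc)⟩
  have hNp : Lc ^ (ℓ + 1) = Lc ^ ℓ * Lc := pow_succ Lc ℓ
  have hcast : (((Lc ^ (ℓ + k + 1) : ℕ) : ℝ)) = (Lc : ℝ) ^ (ℓ + k + 1) := by push_cast; rfl
  have hcastP : (((Lc ^ (ℓ + 1) : ℕ) : ℝ)) = (Lc : ℝ) ^ (ℓ + 1) := by push_cast; rfl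
  have hcastM : (((Lc ^ ℓ : ℕ) : ℝ)) = (Lc : ℝ) ^ ℓ := by push_cast; rfl
  set RWn : ℕ := 2 * (2 * (d + 1) * (Lc + 1) * Lc ^ ℓ) with hRWn
  set RW : ℝ := ((d : ℝ) + 1) * (4 * ((d : ℝ) + 1) * (Lc + 1)) * ((Lc ^ (ℓ + k + 1) : ℕ) : ℝ) with hRW
  set RU : ℝ := ((d : ℝ) + 1) * ((4 * ((d : ℝ) + 1) + 1) + 1) * ((Lc ^ (ℓ + k + 1) : ℕ) : ℝ) with hRU
  have hS := sandwich_sub_le (d := d) (N := Lc ^ (ℓ + k + 1)) (κ := κ) (CA := CA) (CB := CB) (CH := CH)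
    (CA' := CA') (CB' := CB') (CH' := CH') (dA := dA) (dB := dB) (dH := dH)
    (Mass := (((2 * RWn + 1) ^ (d + 1) : ℕ) : ℝ) * (((d : ℝ) + 1) * (((d : ℝ) + 1) *
      ((((2 * (4 * (d + 1) + 1) + 1) ^ (d + 1) : ℕ) : ℝ) * (2 * (ell (d + 1) Lc : ℝ) ^ 2 / (((Lc ^ ℓ : ℕ) : ℝ)) ^ (2 * (d + 1)))))))
    (RW := RW) (RU := RU) (x' := x') (u' := u') (z' := z') (A := A) (B := B) (H := H) (A' := A') (B' := B') (H' := H')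
    (T := fun μ v w l y l' => onLat (Lc ^ (ℓ + 1)) (fun Y => avgLift (Lc ^ ℓ) (hessFFAt (toSite r) Lc μ Y)) v w y (Sum.inl l) (Sum.inl l'))
    (Sw := fun y => Fintype.piFinset fun j => Finset.Icc (y j - RWn) (y j + RWn))
    (Su := fun y => (Fintype.piFinset fun j =>
        Finset.Icc (quo (Lc ^ (ℓ + 1)) y j - (4 * (d + 1) + 1 : ℕ)) (quo (Lc ^ (ℓ + 1)) y j + (4 * (d + 1) + 1 : ℕ))).image
      (fun Y : Site (d + 1) => ((Lc ^ (ℓ + 1) : ℕ) : ℤ) • Y))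
    hκ hA hB hH hA' hB' hH' hdA hdB hdH
    (fun μ v w l y l' hne => mem_boxW_of_ne_zero hr (Lc ^ (ℓ + 1)) (Lc ^ ℓ) hne)
    (fun μ v w l y l' hne => mem_imageY_of_ne_zero hr (Lc ^ (ℓ + 1)) (Lc ^ ℓ) hNp hne)
    (fun y w hw => by
      have h := l1_le_of_mem_box hw
      have hle : ((d : ℝ) + 1) * RWn ≤ RW := by
        rw [hRW, hRWn, hcast]
        push_cast
        have hmono : ((Lc : ℝ) ^ ℓ) ≤ (Lc : ℝ) ^ (ℓ + k + 1) := pow_le_pow_right₀ hL1 (by omega)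
        nlinarith [hmono, show (0 : ℝ) ≤ ((d : ℝ) + 1) * (4 * ((d : ℝ) + 1) * (Lc + 1)) by positivity]
      exact h.trans hle)
    (fun y v hv => by
      have h := l1_le_of_mem_imageY (d := d) (Lc ^ (ℓ + 1)) hv
      have hle : ((d : ℝ) + 1) * ((Lc ^ (ℓ + 1) : ℕ) : ℝ) * ((4 * (d + 1) + 1 : ℕ) + 1) ≤ RU := by
        rw [hRU, hcastP, hcast]
        push_cast
        have hmono : ((Lc : ℝ) ^ (ℓ + 1)) ≤ (Lc : ℝ) ^ (ℓ + k + 1) := pow_le_pow_right₀ hL1 (by omega)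
        nlinarith [hmono, show (0 : ℝ) ≤ ((d : ℝ) + 1) * ((4 * ((d : ℝ) + 1) + 1) + 1) by positivity]
      exact h.trans hle)
    (fun y l' => table_mass_le hr (Lc ^ (ℓ + 1)) (Lc ^ ℓ) y l' RWn)
  have hNpos : (0 : ℝ) < ((Lc ^ (ℓ + k + 1) : ℕ) : ℝ) := by rw [hcast]; positivity
  have hRW' : RW / ((Lc ^ (ℓ + k + 1) : ℕ) : ℝ) = ((d : ℝ) + 1) * (4 * ((d : ℝ) + 1) * (Lc + 1)) := by
    rw [hRW]; field_simp
  have hRU' : RU / ((Lc ^ (ℓ + k + 1) : ℕ) : ℝ) = ((d : ℝ) + 1) * ((4 * ((d : ℝ) + 1) + 1) + 1) := by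
    rw [hRU]; field_simp
  rw [hRW', hRU', hcastM] at hS
  exact hS

end Summit.QuantumFields.BalabanUV.Beta.GAN24.TaylorDiffLamAt

end
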